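import Summits.BirchSwinnertonDyer.BirchSwinnertonDyer.Theorems.GoldfeldAllTwistsTwoConverseTwinGenusUnitCircle
import Summits.BirchSwinnertonDyer.BirchSwinnertonDyer.Theorems.GoldfeldAllTwistsTwoConverseTwinGenusRootsOfUnity
import HarnessLib

set_option linter.dupNamespace false -- namespace `…BirchSwinnertonDyer.BirchSwinnertonDyer…` is the cell's (D-0017 nested layout)
set_option autoImplicit false

/-!
# Twin″ (item 19140), LINE U, file U2b — the EXPLICIT CLASS step: the genus norms of `x(y) − 2` at the level-49 Heegner points
# differ by ROOTS OF UNITY, and `σ₂(u)·σ₃(u)` is a SQUARE in `H_K` whenever `σ₂, σ₃ ∈ Gal(H_K/K)` act alike on `√−1`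

Cell `bsd-goldfeld`, seat `bsd-goldfeld-s1p-c301` (prover, gen 14); ORDER «LINE U — UNIT CIRCLE on 𝒮|σ=−1» (planner (cliii));
`--supports stmt-BirchSwinnertonDyer-19140` (twin″) as a HELPER; memo `HOME/INERT7-UNIT-CIRCLE.md` §3 (streamlined: no genus theory of
`Cl(−4aℓ)`, no `λ`, no 4-rank input). Named print used: ty's (F-η) `x049_x_sub_two_eq_etaQuotient` as the binder `hEta` (through U1);
the integrality of the `x(P_q) − 2` enters as the explicit hypothesis `hint` (discharged from Deuring's (F-D) in file U2c).
SETTING (all data are ARGUMENTS, as in c3's `map_sum_filter_eq_of_stable`): `K` imaginary quadratic, Heegner hypothesis at `49`, `ι : K → ℂ`,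
`H` a Heegner datum, `Dt` a parametrisation of `X₀(49) → 49a1` with `|c| = 1`, the Shimura-reciprocity data over `H_K = singularModuliField K ι`
(lifts `P_q ∈ E(H_K)` of `φ(τ_q)`, `θ : Cl(𝒪_{d_K}) ≃* Gal(H_K/K)` with the transport law — the tree's `heegnerPoints_shimuraReciprocity_holds`),
affine coordinates `P_q = (x_q, y_q)`, and for a class `γ₀` the coset product `u = ∏_{[𝔞_q] ∈ Cl²γ₀} (x_q − 2)`.
* §1 transport: `θ(γ)` maps `x_q` to `x_{q'}` with `[𝔞_{q'}] = γ[𝔞_q]` (`exists_apply_xCoord_eq`), hence filtered products to translated ones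
  (`map_prod_filter_xCoord`, `map_prod_sqCoset_xCoord`), all of the same size (`card_filter_translate`, `card_filter_sqCoset_eq`), and
  `σ⁻¹(u) = σ(u)` (`map_symm_prod_sqCoset_eq`: `Cl/Cl²` has exponent `2`).
* §2 **`norm_ringHom_prod_sqCoset_sq`**: `‖φ(u)‖² = 7^{#}` for EVERY `φ : H_K →+* ℂ` (U1's unit circle at `H_K ⊂ ℂ`, moved to all embeddings
  by U2a's `exists_algEquiv_norm_eq_of_ringHom` and §1).
* §3 **`exists_pow_map_div_eq_one`**: granted `hint`, `σ(u)/u` is a unit of `𝓞_{H_K}` (all coset products generate the same ideal power) of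
  modulus `1` at every embedding, hence a ROOT OF UNITY (Kronecker; Mathlib `NumberField.Embeddings.pow_eq_one_of_norm_eq_one`).
* §4 **`isSquare_map_mul_map_prod_sqCoset`**: for `σ₂, σ₃ ∈ Gal(H_K/K)` with `σ₂ j = σ₃ j`, `j² = −1`: `IsSquare (σ₂(u)·σ₃(u))` — with
  `c_σ := σ(u)/u`: `τ := σ₂σ₃` fixes `j`, `τ(c_τ) = c_τ⁻¹` (§1), so `c_τ` is a square (U2a); `c_τ = σ₂(c_{σ₃})·c_{σ₂}` and `σ₂(c_{σ₃})/c_{σ₃}`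
  is a square (U2a); hence `σ₂(u)σ₃(u) = c_{σ₂}c_{σ₃}u²` is a square. For the two «anti-`i`» cosets this is `α_{H_K}(Q₂ − Q₃) = 1`, the
  class that decides the second halving of the genus point on `𝒮|σ=−1` (memo §4 (C1); files U3–U4, NOT done here).
HONEST FRAMING: algebra of CM values of the modular unit `x − 2` at Heegner points of `X₀(49)`; no `L`-value, Selmer group or case of twin″ /
K12₂″ is decided here; BSD is not proved by any of this.
References: B. Gross, *Heegner points on X₀(N)* (1984), §I.1 [Gross1984]; H. Darmon, *Rational points on modular elliptic curves* (2004),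
Thm. 3.6–3.7 [Darmon2004]; L. Kronecker (1857) / Mathlib `pow_eq_one_of_norm_eq_one`; G. Ligozat, Mém. SMF 43 (1975) (via `hEta`) [Ligozat1975].
-/

noncomputable section

open scoped Classical UpperHalfPlane

open Complex NumberField Polynomial
open Literature.NumberTheory.EllipticCurves Literature.NumberTheory.EllipticCurves.ModularForms
open Literature.Computability.Cryptography.Hallgren2005 Literature.Computability.Cryptography.Hallgren2005.OrderCl

namespace Summit.BirchSwinnertonDyer.BirchSwinnertonDyer.Theorems.GoldfeldGoodTwists

variable {K : Type} [Field K] [NumberField K]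


section ExplicitClass

variable (hK : IsImaginaryQuadratic K) (hH : SatisfiesHeegnerHypothesis 49 K) (ι : K →+* ℂ)
  (H : HeegnerDatum 49 (NumberField.discr K)) (Dt : ModularParametrizationData cm7 49)
  (P : H.reps → (cm7.baseChange (singularModuliField K ι)).toAffine.Point)
  (hP : ∀ q : H.reps, WeierstrassCurve.Affine.Point.map (singularModuliField K ι).subtype.toRatAlgHom (P q) =
    Dt.φ (heegnerTau q))
  (θ : ClassGroup (OrderCl.QO hK.negDiscr) ≃* (singularModuliField K ι ≃ₐ[K] singularModuliField K ι))
  (hθ : ∀ (γ : ClassGroup (OrderCl.QO hK.negDiscr)) (q : H.reps), ∃ q' : H.reps,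
    heegnerFormClass hK q' = γ * heegnerFormClass hK q ∧
    WeierstrassCurve.Affine.Point.map
      (θ γ : singularModuliField K ι →ₐ[K] singularModuliField K ι) (P q) = P q')
  (x y : H.reps → singularModuliField K ι)
  (hxy : ∀ q : H.reps, ∃ h, P q = .some (x q) (y q) h)
  (hint : ∃ I : Ideal (𝓞 (singularModuliField K ι)), ∀ q : H.reps, ∃ w : 𝓞 (singularModuliField K ι),
    (w : singularModuliField K ι) = x q - 2 ∧ Ideal.span {w} = I)

/-! ## §1 Transport of the `x`-coordinates and of the coset products -/

include hθ hxy in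
/-- `θ(γ)` maps `x_q` to `x_{q'}` with `[𝔞_{q'}] = γ·[𝔞_q]` (transport law of the lifts, read on affine coordinates). [cite: Darmon2004, Thm. 3.7] -/
theorem exists_apply_xCoord_eq (γ : ClassGroup (OrderCl.QO hK.negDiscr)) (q : H.reps) :
    ∃ q' : H.reps, heegnerFormClass hK q' = γ * heegnerFormClass hK q ∧ θ γ (x q) = x q' := by
  obtain ⟨q', hq', hmap⟩ := hθ γ q
  obtain ⟨h, hq⟩ := hxy q
  obtain ⟨h', hq''⟩ := hxy q'
  refine ⟨q', hq', ?_⟩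
  rw [hq, hq'', WeierstrassCurve.Affine.Point.map_some] at hmap
  exact (WeierstrassCurve.Affine.Point.some.injEq _ _ _ _ _ _).mp hmap |>.1

include hθ hxy in
/-- `θ(γ)` maps the filtered product `∏_{p[𝔞_q]} (x_q − 2)` to `∏_{p(γ⁻¹[𝔞_q])} (x_q − 2)` (reindexing along the transport,
injectivity of `q ↦ [𝔞_q]` on representatives). [cite: Darmon2004, Thm. 3.7] -/
theorem map_prod_filter_xCoord (γ : ClassGroup (OrderCl.QO hK.negDiscr))
    (p : ClassGroup (OrderCl.QO hK.negDiscr) → Prop) :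
    θ γ (∏ q ∈ Finset.univ.filter (fun q : H.reps ↦ p (heegnerFormClass hK q)), (x q - 2)) =
      ∏ q ∈ Finset.univ.filter (fun q : H.reps ↦ p (γ⁻¹ * heegnerFormClass hK q)), (x q - 2) := by
  set F := Finset.univ.filter (fun q : H.reps ↦ p (heegnerFormClass hK q)) with hF
  set F' := Finset.univ.filter (fun q : H.reps ↦ p (γ⁻¹ * heegnerFormClass hK q)) with hF'
  choose e he using exists_apply_xCoord_eq hK ι H P θ hθ x y hxy γ
  have he_F : ∀ q ∈ F, e q ∈ F' := fun q hq ↦ by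
    rw [hF, Finset.mem_filter] at hq
    rw [hF', Finset.mem_filter]
    exact ⟨Finset.mem_univ _, by rw [(he q).1, inv_mul_cancel_left]; exact hq.2⟩
  have he_inj : Set.InjOn e F := fun q₁ _ q₂ _ h ↦ by
    have h₁ := (he q₁).1
    have h₂ := (he q₂).1
    rw [h] at h₁
    exact heegnerFormClass_injective_reps hK H (mul_left_cancel (h₁.symm.trans h₂))
  have hcard : F'.card ≤ F.card := by
    -- `F'` injects into `F` via the transport for `γ⁻¹`
    choose e' he' using exists_apply_xCoord_eq hK ι H P θ hθ x y hxy γ⁻¹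
    refine Finset.card_le_card_of_injOn e' (fun q hq ↦ ?_) (fun q₁ _ q₂ _ h ↦ ?_)
    · rw [hF', Finset.coe_filter] at hq
      rw [hF, Finset.coe_filter]
      exact ⟨Finset.mem_univ _, by rw [(he' q).1]; exact hq.2⟩
    · have h₁ := (he' q₁).1
      have h₂ := (he' q₂).1
      rw [h] at h₁
      exact heegnerFormClass_injective_reps hK H (mul_left_cancel (h₁.symm.trans h₂))
  rw [map_prod]
  calc ∏ q ∈ F, θ γ (x q - 2) = ∏ q ∈ F, (x (e q) - 2) :=
        Finset.prod_congr rfl fun q _ ↦ by rw [map_sub, (he q).2, map_ofNat]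
    _ = ∏ q ∈ F', (x q - 2) :=
        Finset.prod_nbij e he_F he_inj (Finset.surjOn_of_injOn_of_card_le e he_F he_inj hcard) (fun _ _ ↦ rfl)

include hθ hxy in
/-- Translated filters have the same size. [cite: Gross1984, §I.1] -/
theorem card_filter_translate (γ : ClassGroup (OrderCl.QO hK.negDiscr))
    (p : ClassGroup (OrderCl.QO hK.negDiscr) → Prop) :
    (Finset.univ.filter (fun q : H.reps ↦ p (γ⁻¹ * heegnerFormClass hK q))).card =
      (Finset.univ.filter (fun q : H.reps ↦ p (heegnerFormClass hK q))).card := by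
  apply le_antisymm
  · choose e' he' using exists_apply_xCoord_eq hK ι H P θ hθ x y hxy γ⁻¹
    refine Finset.card_le_card_of_injOn e' (fun q hq ↦ ?_) (fun q₁ _ q₂ _ h ↦ ?_)
    · rw [Finset.coe_filter] at hq
      rw [Finset.coe_filter]
      exact ⟨Finset.mem_univ _, by rw [(he' q).1]; exact hq.2⟩
    · have h₁ := (he' q₁).1
      have h₂ := (he' q₂).1
      rw [h] at h₁
      exact heegnerFormClass_injective_reps hK H (mul_left_cancel (h₁.symm.trans h₂))
  · choose e he using exists_apply_xCoord_eq hK ι H P θ hθ x y hxy γ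
    refine Finset.card_le_card_of_injOn e (fun q hq ↦ ?_) (fun q₁ _ q₂ _ h ↦ ?_)
    · rw [Finset.coe_filter] at hq
      rw [Finset.coe_filter]
      exact ⟨Finset.mem_univ _, by rw [(he q).1, inv_mul_cancel_left]; exact hq.2⟩
    · have h₁ := (he q₁).1
      have h₂ := (he q₂).1
      rw [h] at h₁
      exact heegnerFormClass_injective_reps hK H (mul_left_cancel (h₁.symm.trans h₂))


/-! ## §2 The unit circle at every complex embedding of `H_K` -/

include hH hP hxy in
/-- U1's unit circle for the lifted coordinates (subtype-indexed bridge to `prod_norm_x_sub_two_sq_eq_seven_pow`): at `H_K ⊂ ℂ`,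
`∏_{p[𝔞_q]} ‖x_q − 2‖² = 7^{#}` for every `𝔫`-stable `p`. [cite: Gross1984, §I.1] -/
theorem prod_norm_coe_xCoord_sub_two_sq (hEta : x049_x_sub_two_eq_etaQuotient) (hc : |Dt.c| = 1)
    (p : ClassGroup (OrderCl.QO hK.negDiscr) → Prop)
    (hp : ∀ c, p (c * (heegnerFormClass hK ((49 : ℤ), H.β, (H.β ^ 2 - NumberField.discr K) / (4 * 49)))⁻¹) ↔ p c) :
    ∏ q ∈ Finset.univ.filter (fun q : H.reps ↦ p (heegnerFormClass hK q)),
        ‖((x q : singularModuliField K ι) : ℂ) - 2‖ ^ 2 =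
      7 ^ (Finset.univ.filter (fun q : H.reps ↦ p (heegnerFormClass hK q))).card := by
  -- extend `x, y` to all triples and apply U1
  set x' : ℤ × ℤ × ℤ → ℂ := fun Q ↦ if h : Q ∈ H.reps then ((x ⟨Q, h⟩ : singularModuliField K ι) : ℂ) else 0
    with hx'
  set y' : ℤ × ℤ × ℤ → ℂ := fun Q ↦ if h : Q ∈ H.reps then ((y ⟨Q, h⟩ : singularModuliField K ι) : ℂ) else 0
    with hy'
  have hxq : ∀ q : H.reps, x' q = ((x q : singularModuliField K ι) : ℂ) := fun q ↦ by
    rw [hx']; exact dif_pos q.2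
  have hxy' : ∀ Q ∈ H.reps, ∃ h, Dt.φ (heegnerTau Q) = .some (x' Q) (y' Q) h := fun Q hQ ↦ by
    obtain ⟨h, hq⟩ := hxy ⟨Q, hQ⟩
    have hmap := hP ⟨Q, hQ⟩
    rw [hq, WeierstrassCurve.Affine.Point.map_some] at hmap
    have e1 : x' Q = ((x ⟨Q, hQ⟩ : singularModuliField K ι) : ℂ) := dif_pos hQ
    have e2 : y' Q = ((y ⟨Q, hQ⟩ : singularModuliField K ι) : ℂ) := dif_pos hQ
    rw [e1, e2]
    exact ⟨_, hmap.symm⟩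
  have hU := prod_norm_x_sub_two_sq_eq_seven_pow hEta hK hH H p hp Dt hc x' y' hxy'
  have hprod : ∏ q ∈ Finset.univ.filter (fun q : H.reps ↦ p (heegnerFormClass hK q)),
        ‖((x q : singularModuliField K ι) : ℂ) - 2‖ ^ 2 =
      ∏ Q ∈ H.reps.filter (fun Q ↦ p (heegnerFormClass hK Q)), ‖x' Q - 2‖ ^ 2 := by
    rw [Finset.prod_filter, Finset.prod_filter, Finset.univ_eq_attach,
      ← Finset.prod_attach H.reps (fun Q ↦ if p (heegnerFormClass hK Q) then ‖x' Q - 2‖ ^ 2 else 1)]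
    exact Finset.prod_congr rfl fun q _ ↦ by rw [hxq q]
  have hcard : (Finset.univ.filter (fun q : H.reps ↦ p (heegnerFormClass hK q))).card =
      (H.reps.filter (fun Q ↦ p (heegnerFormClass hK Q))).card := by
    rw [Finset.card_filter, Finset.card_filter, Finset.univ_eq_attach,
      ← Finset.sum_attach H.reps (fun Q ↦ if p (heegnerFormClass hK Q) then 1 else 0)]
  rw [hprod, hcard, hU]

include hH hP hθ hxy in
/-- **Unit circle at EVERY complex embedding of `H_K`**: `‖φ(∏_{[𝔞_q] ∈ Cl²γ₀} (x_q − 2))‖² = 7^{#}` for all `φ : H_K →+* ℂ`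
(`φ` has the absolute values of some `σ = θ(γ) ∈ Gal(H_K/K)` by U2a, `σ` translates the coset, U1 at `H_K ⊂ ℂ`). [cite: Gross1984, §I.1] -/
theorem norm_ringHom_prod_sqCoset_sq (hEta : x049_x_sub_two_eq_etaQuotient) (hc : |Dt.c| = 1)
    (φ : singularModuliField K ι →+* ℂ) (γ₀ : ClassGroup (OrderCl.QO hK.negDiscr)) :
    ‖φ (∏ q ∈ Finset.univ.filter (fun q : H.reps ↦ ∃ δ, heegnerFormClass hK q = δ ^ 2 * γ₀), (x q - 2))‖ ^ 2 =
      7 ^ (Finset.univ.filter (fun q : H.reps ↦ ∃ δ, heegnerFormClass hK q = δ ^ 2 * γ₀)).card := by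
  obtain ⟨σ, hσ⟩ := exists_algEquiv_norm_eq_of_ringHom hK ι φ
  set γ := θ.symm σ with hγ
  have hσγ : σ = θ γ := by rw [hγ, MulEquiv.apply_symm_apply]
  rw [hσ, hσγ, map_prod_filter_xCoord hK ι H P θ hθ x y hxy γ (fun c ↦ ∃ δ, c = δ ^ 2 * γ₀)]
  -- the translated filter is the coset of `γ γ₀`
  have hfilt : Finset.univ.filter (fun q : H.reps ↦ ∃ δ, γ⁻¹ * heegnerFormClass hK q = δ ^ 2 * γ₀) =
      Finset.univ.filter (fun q : H.reps ↦ ∃ δ, heegnerFormClass hK q = δ ^ 2 * (γ * γ₀)) := by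
    refine Finset.filter_congr fun q _ ↦ ⟨fun ⟨δ, hδ⟩ ↦ ⟨δ, ?_⟩, fun ⟨δ, hδ⟩ ↦ ⟨δ, ?_⟩⟩
    · rw [inv_mul_eq_iff_eq_mul] at hδ; rw [hδ, mul_left_comm]
    · rw [inv_mul_eq_iff_eq_mul, hδ, mul_left_comm]
  rw [hfilt]
  push_cast
  simp_rw [show ((2 : singularModuliField K ι) : ℂ) = 2 from map_ofNat (singularModuliField K ι).subtype 2]
  rw [norm_prod, ← Finset.prod_pow, prod_norm_coe_xCoord_sub_two_sq hK hH ι H Dt P hP x y hxy hEta hc (fun c ↦ ∃ δ, c = δ ^ 2 * (γ * γ₀))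
    (fun c ↦ sqCoset_stable_mul_inv (exists_levelClass_eq_sq hK hH H) c), ← hfilt,
    card_filter_translate hK ι H P θ hθ x y hxy γ (fun c ↦ ∃ δ, c = δ ^ 2 * γ₀)]



include hθ hxy in
/-- `θ(γ)` maps the coset product of `γ₀` to that of `γγ₀`. [cite: Darmon2004, Thm. 3.7] -/
theorem map_prod_sqCoset_xCoord (γ γ₀ : ClassGroup (OrderCl.QO hK.negDiscr)) :
    θ γ (∏ q ∈ Finset.univ.filter (fun q : H.reps ↦ ∃ δ, heegnerFormClass hK q = δ ^ 2 * γ₀), (x q - 2)) =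
      ∏ q ∈ Finset.univ.filter (fun q : H.reps ↦ ∃ δ, heegnerFormClass hK q = δ ^ 2 * (γ * γ₀)), (x q - 2) := by
  rw [map_prod_filter_xCoord hK ι H P θ hθ x y hxy γ (fun c ↦ ∃ δ, c = δ ^ 2 * γ₀)]
  congr 1
  refine Finset.filter_congr fun q _ ↦ ⟨fun ⟨δ, hδ⟩ ↦ ⟨δ, ?_⟩, fun ⟨δ, hδ⟩ ↦ ⟨δ, ?_⟩⟩
  · rw [inv_mul_eq_iff_eq_mul] at hδ; rw [hδ, mul_left_comm]
  · rw [inv_mul_eq_iff_eq_mul, hδ, mul_left_comm]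

include hθ hxy in
/-- All `Cl²`-cosets meet `H.reps` in sets of the same size. [cite: Gross1984, §I.1] -/
theorem card_filter_sqCoset_eq (γ γ₀ : ClassGroup (OrderCl.QO hK.negDiscr)) :
    (Finset.univ.filter (fun q : H.reps ↦ ∃ δ, heegnerFormClass hK q = δ ^ 2 * (γ * γ₀))).card =
      (Finset.univ.filter (fun q : H.reps ↦ ∃ δ, heegnerFormClass hK q = δ ^ 2 * γ₀)).card := by
  have hfilt : Finset.univ.filter (fun q : H.reps ↦ ∃ δ, γ⁻¹ * heegnerFormClass hK q = δ ^ 2 * γ₀) =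
      Finset.univ.filter (fun q : H.reps ↦ ∃ δ, heegnerFormClass hK q = δ ^ 2 * (γ * γ₀)) := by
    refine Finset.filter_congr fun q _ ↦ ⟨fun ⟨δ, hδ⟩ ↦ ⟨δ, ?_⟩, fun ⟨δ, hδ⟩ ↦ ⟨δ, ?_⟩⟩
    · rw [inv_mul_eq_iff_eq_mul] at hδ; rw [hδ, mul_left_comm]
    · rw [inv_mul_eq_iff_eq_mul, hδ, mul_left_comm]
  rw [← hfilt, card_filter_translate hK ι H P θ hθ x y hxy γ (fun c ↦ ∃ δ, c = δ ^ 2 * γ₀)]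

/-! ## §3 `σ(u)/u` is a root of unity -/

include hint in
/-- Granted `hint`, every coset product has an integral model `W ∈ 𝓞_{H_K}` with `(W) = I^{#}`. [folklore] -/
theorem exists_integer_prod_sqCoset (γ₀ : ClassGroup (OrderCl.QO hK.negDiscr)) :
    ∃ (I : Ideal (𝓞 (singularModuliField K ι))) (W : 𝓞 (singularModuliField K ι)),
      (∀ γ₁ : ClassGroup (OrderCl.QO hK.negDiscr), ∃ W₁ : 𝓞 (singularModuliField K ι),
        (W₁ : singularModuliField K ι) =
          ∏ q ∈ Finset.univ.filter (fun q : H.reps ↦ ∃ δ, heegnerFormClass hK q = δ ^ 2 * γ₁), (x q - 2) ∧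
        Ideal.span {W₁} = I ^ (Finset.univ.filter (fun q : H.reps ↦ ∃ δ, heegnerFormClass hK q = δ ^ 2 * γ₁)).card) ∧
      (W : singularModuliField K ι) =
        ∏ q ∈ Finset.univ.filter (fun q : H.reps ↦ ∃ δ, heegnerFormClass hK q = δ ^ 2 * γ₀), (x q - 2) ∧
      Ideal.span {W} = I ^ (Finset.univ.filter (fun q : H.reps ↦ ∃ δ, heegnerFormClass hK q = δ ^ 2 * γ₀)).card := by
  obtain ⟨I, hI⟩ := hint
  choose w hw hwI using hI
  have key : ∀ γ₁ : ClassGroup (OrderCl.QO hK.negDiscr), ∃ W₁ : 𝓞 (singularModuliField K ι),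
      (W₁ : singularModuliField K ι) =
        ∏ q ∈ Finset.univ.filter (fun q : H.reps ↦ ∃ δ, heegnerFormClass hK q = δ ^ 2 * γ₁), (x q - 2) ∧
      Ideal.span {W₁} = I ^ (Finset.univ.filter (fun q : H.reps ↦ ∃ δ, heegnerFormClass hK q = δ ^ 2 * γ₁)).card :=
    fun γ₁ ↦ ⟨∏ q ∈ Finset.univ.filter (fun q : H.reps ↦ ∃ δ, heegnerFormClass hK q = δ ^ 2 * γ₁), w q,
      by rw [RingOfIntegers.coe_eq_algebraMap, map_prod]
         exact Finset.prod_congr rfl fun q _ ↦ by rw [← RingOfIntegers.coe_eq_algebraMap]; exact hw q,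
      by rw [← Ideal.prod_span_singleton, Finset.prod_congr rfl fun q _ ↦ hwI q, Finset.prod_const]⟩
  obtain ⟨W, hW, hWI⟩ := key γ₀
  exact ⟨I, W, key, hW, hWI⟩

include hH hP hθ hxy hint in
/-- **`σ(u)/u` is a root of unity** (and `u ≠ 0`) for every `σ ∈ Gal(H_K/K)` and every coset product `u`, granted `hint`: `σ(u)` is the
product over the translated coset (§1), both generate `I^{#}`, so `σ(u)/u ∈ 𝓞_{H_K}^×`; it has modulus `1` at every embedding (§2);
Kronecker's theorem (Mathlib `NumberField.Embeddings.pow_eq_one_of_norm_eq_one`). [cite: Gross1984, §I.1] -/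
theorem exists_pow_map_div_eq_one (hEta : x049_x_sub_two_eq_etaQuotient) (hc : |Dt.c| = 1)
    (σ : singularModuliField K ι ≃ₐ[K] singularModuliField K ι) (γ₀ : ClassGroup (OrderCl.QO hK.negDiscr)) :
    (∏ q ∈ Finset.univ.filter (fun q : H.reps ↦ ∃ δ, heegnerFormClass hK q = δ ^ 2 * γ₀), (x q - 2)) ≠ 0 ∧
    ∃ n : ℕ, 0 < n ∧
      (σ (∏ q ∈ Finset.univ.filter (fun q : H.reps ↦ ∃ δ, heegnerFormClass hK q = δ ^ 2 * γ₀), (x q - 2)) /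
        ∏ q ∈ Finset.univ.filter (fun q : H.reps ↦ ∃ δ, heegnerFormClass hK q = δ ^ 2 * γ₀), (x q - 2)) ^ n = 1 := by
  haveI := numberField_singularModuliField irreducible_classPolynomial_holds hK ι
  set γ := θ.symm σ with hγ
  have hσγ : σ = θ γ := by rw [hγ, MulEquiv.apply_symm_apply]
  -- nonvanishing from the norm identity at the inclusion
  have hnorm := norm_ringHom_prod_sqCoset_sq hK hH ι H Dt P hP θ hθ x y hxy hEta hc
  have hne : ∀ γ₁ : ClassGroup (OrderCl.QO hK.negDiscr),
      (∏ q ∈ Finset.univ.filter (fun q : H.reps ↦ ∃ δ, heegnerFormClass hK q = δ ^ 2 * γ₁), (x q - 2)) ≠ 0 := by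
    intro γ₁ h0
    have h := hnorm (singularModuliField K ι).subtype γ₁
    rw [h0, map_zero, norm_zero, zero_pow two_ne_zero] at h
    exact absurd h.symm (pow_ne_zero _ (by norm_num))
  refine ⟨hne γ₀, ?_⟩
  -- integrality of the ratio
  obtain ⟨I, W, key, hW, hWI⟩ := exists_integer_prod_sqCoset hK ι H x hint γ₀
  obtain ⟨W₁, hW₁, hW₁I⟩ := key (γ * γ₀)
  rw [card_filter_sqCoset_eq hK ι H P θ hθ x y hxy γ γ₀, ← hWI] at hW₁I
  obtain ⟨ε, hε⟩ := (Ideal.span_singleton_eq_span_singleton.mp hW₁I.symm)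
  -- `W * ε = W₁`, so the ratio is the unit `ε`
  have hratio : σ (∏ q ∈ Finset.univ.filter (fun q : H.reps ↦ ∃ δ, heegnerFormClass hK q = δ ^ 2 * γ₀), (x q - 2)) /
      ∏ q ∈ Finset.univ.filter (fun q : H.reps ↦ ∃ δ, heegnerFormClass hK q = δ ^ 2 * γ₀), (x q - 2) =
      ((ε : 𝓞 (singularModuliField K ι)) : singularModuliField K ι) := by
    rw [hσγ, map_prod_sqCoset_xCoord hK ι H P θ hθ x y hxy γ γ₀, ← hW₁, ← hW, ← hε, div_eq_iff (by rw [hW]; exact hne γ₀)]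
    push_cast
    ring
  have hint' : IsIntegral ℤ (((ε : 𝓞 (singularModuliField K ι)) : singularModuliField K ι)) :=
    RingOfIntegers.isIntegral_coe _
  -- norm one at every embedding
  have hn1 : ∀ φ : singularModuliField K ι →+* ℂ, ‖φ ((ε : 𝓞 (singularModuliField K ι)) : singularModuliField K ι)‖ = 1 := by
    intro φ
    rw [← hratio, map_div₀, norm_div, hσγ, map_prod_sqCoset_xCoord hK ι H P θ hθ x y hxy γ γ₀]
    have h1 := hnorm φ (γ * γ₀)
    have h2 := hnorm φ γ₀
    rw [card_filter_sqCoset_eq hK ι H P θ hθ x y hxy γ γ₀] at h1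
    have hpos : 0 < ‖φ (∏ q ∈ Finset.univ.filter (fun q : H.reps ↦ ∃ δ, heegnerFormClass hK q = δ ^ 2 * γ₀), (x q - 2))‖ := by
      rw [norm_pos_iff]; exact (map_ne_zero φ).mpr (hne γ₀)
    rw [div_eq_one_iff_eq hpos.ne']
    exact (pow_left_inj₀ (norm_nonneg _) hpos.le two_ne_zero).mp (h1.trans h2.symm)
  obtain ⟨n, hn, hpow⟩ := NumberField.Embeddings.pow_eq_one_of_norm_eq_one (singularModuliField K ι) ℂ hint' hn1
  exact ⟨n, hn, by rw [hratio]; exact hpow⟩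

include hθ hxy in
/-- `σ⁻¹(u) = σ(u)` for a coset product `u`: `γ⁻¹Cl²γ₀ = γCl²γ₀` since `Cl/Cl²` has exponent `2`. [cite: Gross1984, §I.1] -/
theorem map_symm_prod_sqCoset_eq (σ : singularModuliField K ι ≃ₐ[K] singularModuliField K ι)
    (γ₀ : ClassGroup (OrderCl.QO hK.negDiscr)) :
    σ.symm (∏ q ∈ Finset.univ.filter (fun q : H.reps ↦ ∃ δ, heegnerFormClass hK q = δ ^ 2 * γ₀), (x q - 2)) =
      σ (∏ q ∈ Finset.univ.filter (fun q : H.reps ↦ ∃ δ, heegnerFormClass hK q = δ ^ 2 * γ₀), (x q - 2)) := by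
  set γ := θ.symm σ with hγ
  have hσγ : σ = θ γ := by rw [hγ, MulEquiv.apply_symm_apply]
  have hσγ' : σ.symm = θ γ⁻¹ := by rw [map_inv, hσγ]; rfl
  rw [hσγ', hσγ, map_prod_sqCoset_xCoord hK ι H P θ hθ x y hxy γ γ₀,
    map_prod_sqCoset_xCoord hK ι H P θ hθ x y hxy γ⁻¹ γ₀]
  congr 1
  refine Finset.filter_congr fun q _ ↦ ⟨fun ⟨δ, hδ⟩ ↦ ⟨δ * γ⁻¹, ?_⟩, fun ⟨δ, hδ⟩ ↦ ⟨δ * γ, ?_⟩⟩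
  · rw [hδ]
    conv_rhs => rw [mul_pow, sq γ⁻¹, mul_assoc (δ ^ 2), mul_assoc γ⁻¹ γ⁻¹, inv_mul_cancel_left]
  · rw [hδ]
    conv_rhs => rw [mul_pow, sq γ, mul_assoc (δ ^ 2), mul_assoc γ γ, mul_inv_cancel_left]

/-! ## §4 The square-class theorem -/

include hH hP hθ hxy hint in
/-- **MAIN (memo §3–§4, explicit-class step).** Granted `hint`: for `σ₂, σ₃ ∈ Gal(H_K/K)` with `σ₂ j = σ₃ j` for a square root `j` of
`−1` in `H_K`, and any coset product `u = ∏_{[𝔞_q] ∈ Cl²γ₀} (x_q − 2)`: `IsSquare (σ₂(u)·σ₃(u))`. Proof: `c_σ := σ(u)/u` are roots of unity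
(§3); `τ = σ₂σ₃` fixes `j` and `τ(c_τ) = c_τ⁻¹` (§1: `τ(τu) = u`), so `c_τ ∈ H_K^{×2}` (U2a); `c_τ = σ₂(c_{σ₃})c_{σ₂}` and
`σ₂(c_{σ₃})/c_{σ₃} ∈ H_K^{×2}` (U2a); so `σ₂(u)σ₃(u) = c_{σ₂}c_{σ₃}u² ∈ H_K^{×2}`. [cite: Gross1984, §I.1] [cite: Darmon2004, Thm. 3.7] -/
theorem isSquare_map_mul_map_prod_sqCoset (hEta : x049_x_sub_two_eq_etaQuotient) (hc : |Dt.c| = 1)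
    (σ₂ σ₃ : singularModuliField K ι ≃ₐ[K] singularModuliField K ι) (j : singularModuliField K ι)
    (hj : j ^ 2 = -1) (hστ : σ₂ j = σ₃ j) (γ₀ : ClassGroup (OrderCl.QO hK.negDiscr)) :
    IsSquare (σ₂ (∏ q ∈ Finset.univ.filter (fun q : H.reps ↦ ∃ δ, heegnerFormClass hK q = δ ^ 2 * γ₀), (x q - 2)) *
      σ₃ (∏ q ∈ Finset.univ.filter (fun q : H.reps ↦ ∃ δ, heegnerFormClass hK q = δ ^ 2 * γ₀), (x q - 2))) := by
  set u := ∏ q ∈ Finset.univ.filter (fun q : H.reps ↦ ∃ δ, heegnerFormClass hK q = δ ^ 2 * γ₀), (x q - 2) with hu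
  -- `τ = σ₂σ₃` fixes `j`
  have hj2 : σ₂ j = j ∨ σ₂ j = -j := by
    apply sq_eq_sq_iff_eq_or_eq_neg.mp
    rw [← map_pow, hj, map_neg, map_one]
  have hτj : (σ₂ * σ₃) j = j := by
    rw [AlgEquiv.mul_apply, ← hστ]
    rcases hj2 with h | h
    · rw [h, h]
    · rw [h, map_neg, h, neg_neg]
  -- the roots of unity `c(σ) = σ u / u`
  obtain ⟨hu0, n, hn, hpow⟩ := exists_pow_map_div_eq_one hK hH ι H Dt P hP θ hθ x y hxy hint hEta hc (σ₂ * σ₃) γ₀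
  obtain ⟨-, n₃, hn₃, hpow₃⟩ := exists_pow_map_div_eq_one hK hH ι H Dt P hP θ hθ x y hxy hint hEta hc σ₃ γ₀
  rw [← hu] at hu0 hpow hpow₃
  -- `τ(c τ) = (c τ)⁻¹` from `τ⁻¹ u = τ u`
  have hfix : ∀ σ : singularModuliField K ι ≃ₐ[K] singularModuliField K ι, σ (σ u) = u := fun σ ↦ by
    have h := map_symm_prod_sqCoset_eq hK ι H P θ hθ x y hxy σ γ₀
    rw [← hu] at h
    rw [← h, AlgEquiv.apply_symm_apply]
  have hinv : (σ₂ * σ₃) ((σ₂ * σ₃) u / u) = ((σ₂ * σ₃) u / u)⁻¹ := by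
    rw [map_div₀, hfix, inv_div]
  have hsq1 : IsSquare ((σ₂ * σ₃) u / u) :=
    isSquare_of_pow_eq_one_of_map_eq_inv ((σ₂ * σ₃ : singularModuliField K ι ≃ₐ[K] singularModuliField K ι) :
      singularModuliField K ι →+* singularModuliField K ι) hn hpow hinv hj hτj
  have hsq2 : IsSquare (σ₂ (σ₃ u / u) / (σ₃ u / u)) :=
    isSquare_map_div_of_pow_eq_one (σ₂ : singularModuliField K ι →+* singularModuliField K ι) hn₃ hpow₃
  -- assemble
  have hσ₂u : σ₂ u ≠ 0 := (map_ne_zero σ₂).mpr hu0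
  have hσ₃u : σ₃ u ≠ 0 := (map_ne_zero σ₃).mpr hu0
  have hσ₂₃u : σ₂ (σ₃ u) ≠ 0 := (map_ne_zero σ₂).mpr hσ₃u
  have key : σ₂ u * σ₃ u = ((σ₂ * σ₃) u / u) / (σ₂ (σ₃ u / u) / (σ₃ u / u)) * u ^ 2 := by
    rw [AlgEquiv.mul_apply, map_div₀]
    field_simp
  rw [key]
  exact (hsq1.div hsq2).mul ⟨u, sq u⟩

end ExplicitClass

end Summit.BirchSwinnertonDyer.BirchSwinnertonDyer.Theorems.GoldfeldGoodTwists

end
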